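import Summits.PneNP.PneNP.Theorems.KarlinRubinMonotoneSufficesDecompCensus
import Summits.PneNP.PneNP.Theorems.KarlinRubinMonotoneSufficesStubTransport
import Summits.PneNP.PneNP.Theorems.KarlinRubinMonotoneSufficesStubBruteForce
import Summits.PneNP.PneNP.Theorems.OneSliceSliceMonotonization

/-!
# Crux `MonotoneSuffices` (stmt-PneNP-18026, route KarlinRubin) — decomposition census r1, part 2: the slice split

Part of the DECOMPOSITION r1 audit of the crux (2026-08-17): canonical census
`Cruxes/MonotoneSuffices/STRATEGY-CENSUS.md` (planner-cstrat-stmt-PneNP-18026-r1-0, workfile `DecompositionAudit.lean`) and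
the second-seat addendum (item evidence `STRATEGY-CENSUS-r1b.md`, planner-rtask-PneNP-KarlinRubin-kr-decomp-r1-64ab4eaa-0,
this file's author; the two seats were staffed on the same coordinator instruction and converged independently). Helpers
`--supports stmt-PneNP-18026`; every theorem is a COMPOSITION of landed tree theorems; nothing here is new mathematics —
the files exist so that the census's `strategy: no-strategy` line points at kernel-checked implications instead of prose.

The best typed split of the crux is the registered line `slice-transport` (strategist b1):
`MonotoneSuffices ⇐ TransportSpec ∧ SliceBlind ∧ BruteForceSpec` (+ Berkowitz on the slice, route OneSlice's PROVED item),
glue kernel-checked in `Cruxes/MonotoneSuffices/Lines/slice_transport.lean`, with `TransportSpec` (`stub_transport`, p157354)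
and `BruteForceSpec` (`stub_bruteForce`, p151826) LANDED. This file re-links that glue to the landed stubs (§2, interface and
composition copied from the skeleton) and certifies that the ONE open piece `SliceBlind` gives the crux `X`, the sibling crux
`MonotoneBlind`, polynomial planted-clique hardness for GENERAL circuits and the summit `S` on its own (§3:
`monotoneSuffices_of_sliceBlind`, `monotoneBlind_of_sliceBlind`, `polyHardB2_of_sliceBlind`, `pneNP_of_sliceBlind`) — in the
language of the birth certificate (BC2 (c), RULE-N) the split is a RESTATEMENT of the crux upward, not a redirect.
-/

set_option linter.dupNamespace false -- `Summit.PneNP.PneNP.…`: summit = sub-problem name (D-0017 single-conjunct layout)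

namespace Summit.PneNP.PneNP.Theorems

open Filter Topology Finset
open scoped Classical ENNReal
open Literature.Computability.Complexity Literature.Probability.RandomGraphs.PlantedClique
open Summit.PneNP.PneNP.Theses.KarlinRubin

/-! ## §2 The slice split: interface (copied from the registered skeleton `Lines/slice_transport.lean`) -/

namespace MonotoneSuffices.DecompCensus

/-- The transport slice `m⋆(n) = ⌊C(n,2)/2⌋ + n (⌊log₂ n⌋ + 1)`. -/
def mStar (n : ℕ) : ℕ := n.choose 2 / 2 + n * (Nat.log 2 n + 1)

/-- The planted clique size of the crux, `k_δ(n) = ⌈n^{1/2-δ}⌉`. -/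
noncomputable def kOf (δ : ℝ) (n : ℕ) : ℕ := ⌈(n : ℝ) ^ (1 / 2 - δ)⌉₊

/-- The edge count `|x|` of an edge vector. -/
def eCount {n : ℕ} (x : EdgeVec n) : ℕ := (univ.filter fun e => x e = true).card

/-- Slice type-I error of a test `f` at slice `m`. -/
noncomputable def sliceErrI (n m : ℕ) (f : EdgeVec n → Bool) : ℝ :=
  ((univ.filter fun x : EdgeVec n => eCount x = m ∧ f x = true).card : ℝ) /
    ((univ.filter fun x : EdgeVec n => eCount x = m).card : ℝ)

/-- Slice type-II error of `f` at clique size `k` and slice `m`. -/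
noncomputable def sliceErrII (n k m : ℕ) (f : EdgeVec n → Bool) : ℝ :=
  (((kSubsets n k ×ˢ (univ : Finset (EdgeVec n))).filter fun p =>
      plant p.1 p.2 = p.2 ∧ eCount p.2 = m ∧ f p.2 = false).card : ℝ) /
    (((kSubsets n k ×ˢ (univ : Finset (EdgeVec n))).filter fun p =>
      plant p.1 p.2 = p.2 ∧ eCount p.2 = m).card : ℝ)

/-- The crux's (unconditional) error sum of a circuit family at clique size `k`. -/
noncomputable def errSum (k : ℕ → ℕ) (C : (n : ℕ) → Circuit ((⊤ : SimpleGraph (Fin n)).edgeSet)) (n : ℕ) :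
    ENNReal :=
  (erdosRenyiHalf n).toOuterMeasure {x | (C n).eval x = true} +
    (plantedCliqueDist n (k n)).toOuterMeasure {x | (C n).eval x = false}

/-- The slice error sum of a family at the transport slice `m⋆`. -/
noncomputable def sliceErrSum (δ : ℝ) (C : (n : ℕ) → Circuit ((⊤ : SimpleGraph (Fin n)).edgeSet))
    (n : ℕ) : ℝ :=
  sliceErrI n (mStar n) (C n).eval + sliceErrII n (kOf δ n) (mStar n) (C n).eval

/-- `TransportSpec` (the content of the LANDED stub `stub_transport`). -/
def TransportSpec : Prop :=
  ∀ δ : ℝ, 0 < δ → δ < 1 / 2 → ∃ c₁ : ℕ,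
    ∀ C : (n : ℕ) → Circuit ((⊤ : SimpleGraph (Fin n)).edgeSet),
      (∀ᶠ n : ℕ in atTop, (C n).IsOver B2) → Tendsto (errSum (kOf δ) C) atTop (nhds 0) →
        ∃ C₁ : (n : ℕ) → Circuit ((⊤ : SimpleGraph (Fin n)).edgeSet),
          (∀ᶠ n : ℕ in atTop, (C₁ n).IsOver B2 ∧ (C₁ n).size ≤ (C n).size + n ^ c₁) ∧
            Tendsto (sliceErrSum δ C₁) atTop (nhds 0)

/-- `SliceBlindSpec` (the content of the OPEN stub `stub_sliceBlind`; definitionally the file's `SliceBlind`). -/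
def SliceBlindSpec : Prop :=
  ∀ δ : ℝ, 0 < δ → δ < 1 / 2 → ∃ e : ℕ, 0 < e ∧
    ∀ M : (n : ℕ) → Circuit ((⊤ : SimpleGraph (Fin n)).edgeSet),
      (∀ᶠ n : ℕ in atTop, (M n).IsOver monotoneBasis) → Tendsto (sliceErrSum δ M) atTop (nhds 0) →
        ∀ᶠ n : ℕ in atTop, 2 ^ (Nat.log 2 n ^ 2) ≤ (M n).size ^ e

/-- `BruteForceSpec` (the content of the LANDED stub `stub_bruteForce`). -/
def BruteForceSpec : Prop :=
  ∃ c₄ : ℕ, ∃ M : (n : ℕ) → Circuit ((⊤ : SimpleGraph (Fin n)).edgeSet),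
    (∀ᶠ n : ℕ in atTop, (M n).IsOver monotoneBasis01 ∧ (M n).size ≤ 2 ^ (c₄ * Nat.log 2 n ^ 2)) ∧
      ∀ δ : ℝ, 0 < δ → δ < 1 / 2 → Tendsto (errSum (kOf δ) M) atTop (nhds 0)

/-- `TransportSpec` HOLDS: it is the landed stub `MonotoneSuffices.SliceTransport.stub_transport` (p157354). -/
theorem transportSpec_holds : TransportSpec :=
  Summit.PneNP.PneNP.Theorems.MonotoneSuffices.SliceTransport.stub_transport

/-- `BruteForceSpec` HOLDS: it is the landed stub `MonotoneSuffices.SliceTransport.stub_bruteForce` (p151826). -/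
theorem bruteForceSpec_holds : BruteForceSpec :=
  Summit.PneNP.PneNP.Theorems.MonotoneSuffices.SliceTransport.stub_bruteForce

/-- The file's `SliceBlind` is `SliceBlindSpec`, definitionally. -/
theorem sliceBlindSpec_of_sliceBlind (h : SliceBlind) : SliceBlindSpec := h

/-! ### Elementary lemmas for the compositions (copied from the skeleton) -/

/-- `4 L + 6 ≤ 2^L` for `L ≥ 5`. -/
theorem four_mul_add_six_le_two_pow {L : ℕ} (hL : 5 ≤ L) : 4 * L + 6 ≤ 2 ^ L := by
  induction L, hL using Nat.le_induction with
  | base => norm_num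
  | succ L hL ih =>
    calc 4 * (L + 1) + 6 = (4 * L + 6) + 4 := by ring
      _ ≤ 2 ^ L + 2 ^ L := Nat.add_le_add ih (by
          calc 4 = 2 ^ 2 := by norm_num
            _ ≤ 2 ^ L := Nat.pow_le_pow_right (by norm_num) (by omega))
      _ = 2 ^ (L + 1) := by ring

/-- The transport slice is a proper, nonzero slice for all large `n`. -/
theorem eventually_mStar : ∀ᶠ n : ℕ in atTop, 0 < mStar n ∧ mStar n < n.choose 2 := by
  filter_upwards [eventually_ge_atTop 32] with n hn
  have hn0 : n ≠ 0 := by omega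
  have hL : 5 ≤ Nat.log 2 n := Nat.le_log_of_pow_le (by norm_num) (by simpa using hn)
  have hpow : 2 ^ Nat.log 2 n ≤ n := Nat.pow_log_le_self 2 hn0
  have h46 : 4 * Nat.log 2 n + 6 ≤ n := (four_mul_add_six_le_two_pow hL).trans hpow
  refine ⟨?_, ?_⟩
  · unfold mStar
    have : 0 < n * (Nat.log 2 n + 1) := Nat.mul_pos (by omega) (Nat.succ_pos _)
    omega
  · have h2 := Summit.PneNP.PneNP.Theorems.MonotoneSuffices.SliceTransport.two_mul_choose_two' n
    have hdiv : 2 * (n.choose 2 / 2) ≤ n.choose 2 := Nat.mul_div_le (n.choose 2) 2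
    have hkey : 4 * (n * (Nat.log 2 n + 1)) < n * (n - 1) := by
      have h1 : 4 * (Nat.log 2 n + 1) < n - 1 := by omega
      calc 4 * (n * (Nat.log 2 n + 1)) = n * (4 * (Nat.log 2 n + 1)) := by ring
        _ < n * (n - 1) := Nat.mul_lt_mul_of_pos_left h1 (by omega)
    unfold mStar
    omega

/-- Polynomial absorption: `c₀ ((q - n) + n^{c₁} + n^{c₀}) ≤ q^{2c₀ + c₁ + 3}` whenever `n ≤ q`, `2 ≤ q`. -/
theorem poly_absorb (c₀ c₁ s n : ℕ) (hn : 2 ≤ n) :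
    c₀ * ((s + n ^ c₁) + n ^ c₀) ≤ (s + n) ^ (2 * c₀ + c₁ + 3) := by
  set q := s + n with hq
  have hq2 : 2 ≤ q := le_add_left hn
  have hq1 : 1 ≤ q := by omega
  set b := c₀ + c₁ + 1 with hb
  have hs : s ≤ q ^ b := by
    calc s ≤ q := Nat.le_add_right s n
      _ = q ^ 1 := (pow_one q).symm
      _ ≤ q ^ b := Nat.pow_le_pow_right hq1 (by omega)
  have hn1 : n ^ c₁ ≤ q ^ b :=
    (Nat.pow_le_pow_left (Nat.le_add_left n s) c₁).trans (Nat.pow_le_pow_right hq1 (by omega))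
  have hn0 : n ^ c₀ ≤ q ^ b :=
    (Nat.pow_le_pow_left (Nat.le_add_left n s) c₀).trans (Nat.pow_le_pow_right hq1 (by omega))
  have hsum : (s + n ^ c₁) + n ^ c₀ ≤ 3 * q ^ b := by omega
  have hc₀ : 3 * c₀ ≤ q ^ (c₀ + 2) := by
    have h1 : c₀ < 2 ^ c₀ := Nat.lt_two_pow_self
    calc 3 * c₀ ≤ 4 * 2 ^ c₀ := by omega
      _ = 2 ^ (c₀ + 2) := by ring
      _ ≤ q ^ (c₀ + 2) := Nat.pow_le_pow_left hq2 _
  calc c₀ * ((s + n ^ c₁) + n ^ c₀) ≤ c₀ * (3 * q ^ b) := Nat.mul_le_mul_left _ hsum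
    _ = (3 * c₀) * q ^ b := by ring
    _ ≤ q ^ (c₀ + 2) * q ^ b := Nat.mul_le_mul_right _ hc₀
    _ = q ^ (2 * c₀ + c₁ + 3) := by rw [← pow_add]; congr 1; omega

/-- Slice errors depend only on the values of the test ON the slice (type I). -/
theorem sliceErrI_congr {n m : ℕ} {f g : EdgeVec n → Bool} (h : ∀ x, eCount x = m → f x = g x) :
    sliceErrI n m f = sliceErrI n m g := by
  unfold sliceErrI
  congr 3
  exact filter_congr fun x _ => by
    constructor
    · rintro ⟨hx, hf⟩; exact ⟨hx, (h x hx) ▸ hf⟩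
    · rintro ⟨hx, hg⟩; exact ⟨hx, (h x hx).symm ▸ hg⟩

/-- Slice errors depend only on the values of the test ON the slice (type II). -/
theorem sliceErrII_congr {n k m : ℕ} {f g : EdgeVec n → Bool} (h : ∀ x, eCount x = m → f x = g x) :
    sliceErrII n k m f = sliceErrII n k m g := by
  unfold sliceErrII
  congr 3
  exact filter_congr fun p _ => by
    constructor
    · rintro ⟨hp, hx, hf⟩; exact ⟨hp, hx, (h p.2 hx) ▸ hf⟩
    · rintro ⟨hp, hx, hg⟩; exact ⟨hp, hx, (h p.2 hx).symm ▸ hg⟩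

/-! ### The compositions -/

/-- **The skeleton's composition** (verbatim `monotoneSuffices_of_specs` of `Lines/slice_transport.lean`): transport,
Berkowitz on the slice `m⋆`, the slice lower bound and the brute-force calibration give the BODY of
`KarlinRubin.MonotoneSuffices` by the scale argument. [folklore] -/
theorem monotoneSuffices_of_specs (hT : TransportSpec) (hB : SliceBlindSpec) (hU : BruteForceSpec)
    (hBerk : Summit.PneNP.PneNP.Theses.OneSlice.SliceMonotonization) : MonotoneSuffices := by
  intro δ hδ hδ'
  obtain ⟨e, _he, hblind⟩ := hB δ hδ hδ'
  obtain ⟨c₁, htrans⟩ := hT δ hδ hδ'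
  obtain ⟨c₀, hberk⟩ := hBerk
  obtain ⟨c₄, M₄, hM₄, hM₄err⟩ := hU
  refine ⟨(2 * c₀ + c₁ + 3) * (e * c₄), fun s hyp => ?_⟩
  obtain ⟨C, hC, hCerr⟩ := hyp
  -- (1) transport the unconditional detector to the slice `m⋆`
  obtain ⟨C₁, hC₁, hC₁err⟩ := htrans C (hC.mono fun n h => h.1) hCerr
  -- (2) Berkowitz on the slice, pointwise in `n` (junk off the eventual range)
  let P : ℕ → Prop := fun n => (C₁ n).IsOver B2 ∧ 0 < mStar n ∧ mStar n < n.choose 2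
  let M₁ : (n : ℕ) → Circuit ((⊤ : SimpleGraph (Fin n)).edgeSet) := fun n =>
    if h : P n then (hberk n (mStar n) (C₁ n) h.1 h.2.1 h.2.2).choose else C₁ n
  have hM₁ : ∀ᶠ n : ℕ in atTop, (M₁ n).IsOver monotoneBasis ∧
      (M₁ n).size ≤ c₀ * ((C₁ n).size + n ^ c₀) ∧
        ∀ x : EdgeVec n, eCount x = mStar n → (M₁ n).eval x = (C₁ n).eval x := by
    filter_upwards [hC₁, eventually_mStar] with n h1 h2
    have hP : P n := ⟨h1.1, h2⟩
    have hM : M₁ n = (hberk n (mStar n) (C₁ n) hP.1 hP.2.1 hP.2.2).choose := dif_pos hP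
    rw [hM]
    exact (hberk n (mStar n) (C₁ n) hP.1 hP.2.1 hP.2.2).choose_spec
  -- (3) the monotone circuit has the same slice errors, hence slice-detects
  have hM₁err : Tendsto (sliceErrSum δ M₁) atTop (nhds 0) := by
    refine (hC₁err).congr' ?_
    filter_upwards [hM₁] with n hn
    show sliceErrI n (mStar n) (C₁ n).eval + sliceErrII n (kOf δ n) (mStar n) (C₁ n).eval =
      sliceErrI n (mStar n) (M₁ n).eval + sliceErrII n (kOf δ n) (mStar n) (M₁ n).eval
    rw [sliceErrI_congr (fun x hx => (hn.2.2 x hx).symm), sliceErrII_congr (fun x hx => (hn.2.2 x hx).symm)]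
  -- (4) so it is large, eventually
  have hbig : ∀ᶠ n : ℕ in atTop, 2 ^ (Nat.log 2 n ^ 2) ≤ (M₁ n).size ^ e :=
    hblind M₁ (hM₁.mono fun n h => h.1) hM₁err
  -- (5) hence the budget `(s n + n)^a` covers the monotone brute force
  refine ⟨M₄, ?_, hM₄err δ hδ hδ'⟩
  filter_upwards [hM₄, hbig, hM₁, hC₁, hC, eventually_ge_atTop 2] with n h4 hb h1 hc1 hc hn2
  refine ⟨h4.1, h4.2.trans ?_⟩
  have hsize : (M₁ n).size ≤ c₀ * ((s n + n ^ c₁) + n ^ c₀) :=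
    h1.2.1.trans (Nat.mul_le_mul_left _ (Nat.add_le_add_right (hc1.2.trans (Nat.add_le_add_right hc.2 _)) _))
  have hchain : 2 ^ (Nat.log 2 n ^ 2) ≤ ((s n + n) ^ (2 * c₀ + c₁ + 3)) ^ e :=
    hb.trans ((Nat.pow_le_pow_left hsize e).trans (Nat.pow_le_pow_left (poly_absorb c₀ c₁ (s n) n hn2) e))
  calc 2 ^ (c₄ * Nat.log 2 n ^ 2) = (2 ^ (Nat.log 2 n ^ 2)) ^ c₄ := by rw [← pow_mul, mul_comm]
    _ ≤ (((s n + n) ^ (2 * c₀ + c₁ + 3)) ^ e) ^ c₄ := Nat.pow_le_pow_left hchain c₄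
    _ = (s n + n) ^ ((2 * c₀ + c₁ + 3) * (e * c₄)) := by rw [← pow_mul, ← pow_mul]

/-- **The open piece also gives the SIBLING crux.** Transport + Berkowitz + the slice lower bound give
`KarlinRubin.MonotoneBlind`: a polynomial monotone detector is a `B₂` detector (`{∧₂,∨₂,0,1} ⊆ B₂`), transports to
a polynomial `B₂` slice detector, monotonises on the slice with polynomial overhead, and then `2^{⌊log₂ n⌋²} ≤ poly(n)`
eventually is absurd. [folklore] -/
theorem monotoneBlind_of_specs (hT : TransportSpec) (hB : SliceBlindSpec)
    (hBerk : Summit.PneNP.PneNP.Theses.OneSlice.SliceMonotonization) : MonotoneBlind := by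
  intro δ hδ hδ' c hex
  obtain ⟨C, hC, hCerr⟩ := hex
  obtain ⟨e, _he, hblind⟩ := hB δ hδ hδ'
  obtain ⟨c₁, htrans⟩ := hT δ hδ hδ'
  obtain ⟨c₀, hberk⟩ := hBerk
  have hCB2 : ∀ᶠ n : ℕ in atTop, (C n).IsOver B2 :=
    hC.mono fun n h => h.1.mono karlinRubin_monotoneBasis01_subset_B2
  -- (1) transport the unconditional (monotone, hence B₂) detector to the slice `m⋆`
  obtain ⟨C₁, hC₁, hC₁err⟩ := htrans C hCB2 hCerr
  -- (2) Berkowitz on the slice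
  let P : ℕ → Prop := fun n => (C₁ n).IsOver B2 ∧ 0 < mStar n ∧ mStar n < n.choose 2
  let M₁ : (n : ℕ) → Circuit ((⊤ : SimpleGraph (Fin n)).edgeSet) := fun n =>
    if h : P n then (hberk n (mStar n) (C₁ n) h.1 h.2.1 h.2.2).choose else C₁ n
  have hM₁ : ∀ᶠ n : ℕ in atTop, (M₁ n).IsOver monotoneBasis ∧
      (M₁ n).size ≤ c₀ * ((C₁ n).size + n ^ c₀) ∧
        ∀ x : EdgeVec n, eCount x = mStar n → (M₁ n).eval x = (C₁ n).eval x := by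
    filter_upwards [hC₁, eventually_mStar] with n h1 h2
    have hP : P n := ⟨h1.1, h2⟩
    have hM : M₁ n = (hberk n (mStar n) (C₁ n) hP.1 hP.2.1 hP.2.2).choose := dif_pos hP
    rw [hM]
    exact (hberk n (mStar n) (C₁ n) hP.1 hP.2.1 hP.2.2).choose_spec
  have hM₁err : Tendsto (sliceErrSum δ M₁) atTop (nhds 0) := by
    refine (hC₁err).congr' ?_
    filter_upwards [hM₁] with n hn
    show sliceErrI n (mStar n) (C₁ n).eval + sliceErrII n (kOf δ n) (mStar n) (C₁ n).eval =
      sliceErrI n (mStar n) (M₁ n).eval + sliceErrII n (kOf δ n) (mStar n) (M₁ n).eval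
    rw [sliceErrI_congr (fun x hx => (hn.2.2 x hx).symm), sliceErrII_congr (fun x hx => (hn.2.2 x hx).symm)]
  -- (3) the slice lower bound makes the monotone slice detector quasi-polynomially large …
  have hbig : ∀ᶠ n : ℕ in atTop, 2 ^ (Nat.log 2 n ^ 2) ≤ (M₁ n).size ^ e :=
    hblind M₁ (hM₁.mono fun n h => h.1) hM₁err
  -- (4) … while it is polynomially small
  set D : ℕ := (c + 2) * (2 * c₀ + c₁ + 3) with hD
  have hsmall : ∀ᶠ n : ℕ in atTop, (M₁ n).size ^ e ≤ n ^ (D * e) := by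
    filter_upwards [hM₁, hC₁, hC, eventually_ge_atTop 2] with n h1 hc1 hc hn2
    have hsize : (M₁ n).size ≤ c₀ * ((n ^ c + n ^ c₁) + n ^ c₀) :=
      h1.2.1.trans (Nat.mul_le_mul_left _ (Nat.add_le_add_right (hc1.2.trans (Nat.add_le_add_right hc.2 _)) _))
    have hq : c₀ * ((n ^ c + n ^ c₁) + n ^ c₀) ≤ (n ^ c + n) ^ (2 * c₀ + c₁ + 3) :=
      poly_absorb c₀ c₁ (n ^ c) n hn2
    have hpos : 0 < n := by omega
    have h3 : n ^ c + n ≤ n ^ (c + 2) := by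
      calc n ^ c + n ≤ n ^ (c + 1) + n ^ (c + 1) :=
            Nat.add_le_add (Nat.pow_le_pow_right hpos (Nat.le_succ c))
              (by calc n = n ^ 1 := (pow_one n).symm
                    _ ≤ n ^ (c + 1) := Nat.pow_le_pow_right hpos (by omega))
        _ = 2 * n ^ (c + 1) := by ring
        _ ≤ n * n ^ (c + 1) := Nat.mul_le_mul_right _ hn2
        _ = n ^ (c + 2) := by ring
    have h4 : (n ^ c + n) ^ (2 * c₀ + c₁ + 3) ≤ n ^ D := by
      calc (n ^ c + n) ^ (2 * c₀ + c₁ + 3) ≤ (n ^ (c + 2)) ^ (2 * c₀ + c₁ + 3) := Nat.pow_le_pow_left h3 _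
        _ = n ^ D := by rw [← pow_mul]
    calc (M₁ n).size ^ e ≤ (n ^ D) ^ e := Nat.pow_le_pow_left (hsize.trans (hq.trans h4)) e
      _ = n ^ (D * e) := by rw [← pow_mul]
  obtain ⟨n, hn1, hn2, hn3⟩ := (hbig.and (hsmall.and (eventually_ge_atTop (2 ^ (D * e + 2))))).exists
  exact absurd (hn1.trans hn2) (not_le.2 (pow_lt_two_pow_log_sq hn3))

end MonotoneSuffices.DecompCensus

/-! ## §3 The certificates for the open piece `SliceBlind` -/

open MonotoneSuffices.DecompCensus in
/-- **The open piece gives the crux `X` on its own** (BC2 (c) violation of the slice split): `SliceBlind →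
MonotoneSuffices`, by the skeleton's composition with its two LANDED stubs and Berkowitz. [folklore] -/
theorem monotoneSuffices_of_sliceBlind (h : SliceBlind) : MonotoneSuffices :=
  monotoneSuffices_of_specs transportSpec_holds (sliceBlindSpec_of_sliceBlind h) bruteForceSpec_holds
    sliceMonotonization_proof

open MonotoneSuffices.DecompCensus in
/-- **The open piece gives the sibling crux too**: `SliceBlind → MonotoneBlind`. [folklore] -/
theorem monotoneBlind_of_sliceBlind (h : SliceBlind) : MonotoneBlind :=
  monotoneBlind_of_specs transportSpec_holds (sliceBlindSpec_of_sliceBlind h) sliceMonotonization_proof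

/-- **The open piece gives polynomial planted-clique hardness for GENERAL circuits** (hence it is at least the
nonuniform planted clique conjecture): `SliceBlind → PolyHardB2`. [folklore] -/
theorem polyHardB2_of_sliceBlind (h : SliceBlind) : PolyHardB2 :=
  karlinRubin_noPolyDetector_of_monotoneSuffices_of_monotoneBlind (monotoneSuffices_of_sliceBlind h)
    (monotoneBlind_of_sliceBlind h)

/-- **The open piece gives the summit `S` on its own**: `SliceBlind → PneNP`. [folklore] -/
theorem pneNP_of_sliceBlind (h : SliceBlind) : PneNP :=
  -- route KarlinRubin was retired (2026-08-17) and its route file no longer carries `closes`;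
  -- the same conclusion through the census chain `SliceBlind → PolyHardB2 → PneNP`
  pneNP_of_polyHardB2 (polyHardB2_of_sliceBlind h)


/-- **Registered form** (stub `pneNP_of_sliceMonotoneLowerBound` of stmt-PneNP-18026; `SliceBlind` unfolded): the
quantitative monotone lower bound for slice-conditional detection at `m⋆` ALONE gives `PneNP`. [folklore] -/
theorem pneNP_of_sliceMonotoneLowerBound :
    (∀ δ : ℝ, 0 < δ → δ < 1 / 2 → ∃ e : ℕ, 0 < e ∧ ∀ M : (n : ℕ) → Circuit ((⊤ : SimpleGraph (Fin n)).edgeSet), (∀ᶠ n : ℕ in atTop, (M n).IsOver monotoneBasis) → Tendsto (fun n : ℕ => ((univ.filter fun x : EdgeVec n => (univ.filter fun e => x e = true).card = n.choose 2 / 2 + n * (Nat.log 2 n + 1) ∧ (M n).eval x = true).card : ℝ) / ((univ.filter fun x : EdgeVec n => (univ.filter fun e => x e = true).card = n.choose 2 / 2 + n * (Nat.log 2 n + 1)).card : ℝ) + (((kSubsets n ⌈(n : ℝ) ^ (1 / 2 - δ)⌉₊ ×ˢ (univ : Finset (EdgeVec n))).filter fun p => plant p.1 p.2 = p.2 ∧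 (univ.filter fun e => p.2 e = true).card = n.choose 2 / 2 + n * (Nat.log 2 n + 1) ∧ (M n).eval p.2 = false).card : ℝ) / (((kSubsets n ⌈(n : ℝ) ^ (1 / 2 - δ)⌉₊ ×ˢ (univ : Finset (EdgeVec n))).filter fun p => plant p.1 p.2 = p.2 ∧ (univ.filter fun e => p.2 e = true).card = n.choose 2 / 2 + n * (Nat.log 2 n + 1)).card : ℝ)) atTop (nhds 0) → ∀ᶠ n : ℕ in atTop, 2 ^ (Nat.log 2 n ^ 2) ≤ (M n).size ^ e) → PneNP :=
  fun h => pneNP_of_sliceBlind h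

end Summit.PneNP.PneNP.Theorems
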